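import Literature.Probability.TransportMaps.DobrushinCouplingCompact
import HarnessLib

/-!
# One-site kernels frozen off a region: identity resampling and the Dirac pair coupling
# (the device behind Lemma 3.8 of Conache–Kondratiev–Kozitsky–Pasurek 2015: reconstruct only the
# sites of `D_{N−1}`, where `μ^x ⊗ μ` is consistent)

[topic Probability/TransportMaps]

[ConacheEtAl2015] D. Conache, Yu. Kondratiev, Yu. Kozitsky, T. Pasurek, arXiv:1501.00673, §3.4: the
couplings `ν_s^x ∈ 𝒞(μ^x, μ)` of Lemma 3.8 are obtained from `ν_0^x = μ^x ⊗ μ`,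
`μ^x = μ(·|ℱ_{D_{N−1}})(x)`, by the reconstruction maps `R_ℓ` (16) over sites `ℓ ∈ D_{N−s−1} ⊆ D_{N−1}`
ONLY (§4.3) — `μ^x` is consistent with the specification inside `D_{N−1}` and frozen (equal to `x`)
outside. [Presutti2009] E. Presutti, *Scaling Limits in Statistical Mechanics and Microstructures in
Continuum Mechanics*, §3.2.2 «The setup» (p. 113): the data `(μ, μ', γ, γ', q)` of one-site kernels
and their couplings, formalised in the tree as `DobrushinCouplingCompact.OneSiteKernels`, which asks
invariance and the coupling property at EVERY site.

THIS FILE supplies the bookkeeping that lets a pair of measures consistent only on a region `Λ`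
enter `OneSiteKernels`: off `Λ` one resamples a site FROM ITS OWN CURRENT VALUE (the identity kernel
`idKernel ℓ = δ_{ω_ℓ}`, under which every measure is invariant) and couples the two identity kernels
by the Dirac pair `idPairKernel ℓ = δ_{(ω_ℓ, ω'_ℓ)}`. `kernelOn Λ γ` ∕ `pairKernelOn Λ q` glue the given
kernels on `Λ` with these off `Λ`, and ★ `oneSiteKernels_on` builds `OneSiteKernels` from hypotheses
AT THE SITES OF `Λ` only. (Companion of `DobrushinPecherskySweepRegional.IsDPStepOn`.) No named facts;
nothing model-specific.

## References
* [ConacheEtAl2015] arXiv:1501.00673, §3.4 Lemma 3.8, §4.3.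
* [Presutti2009] §3.2.2 «The setup», p. 113.
-/

noncomputable section

open MeasureTheory ProbabilityTheory Function

open scoped ENNReal

namespace Literature.Probability.TransportMaps

namespace ResampleOffRegion

open DobrushinCouplingCompact (OneSiteKernels)

variable {ι : Type*} {S : Type*} [MeasurableSpace S]

/-- **The identity one-site kernel** `ω ↦ δ_{ω_ℓ}`: resampling site `ℓ` from it changes nothing.
[cite: ConacheEtAl2015, §3.4 Lemma 3.8 (sites outside `D_{N−1}` are never reconstructed)] -/
def idKernel (ℓ : ι) : Kernel (ι → S) S :=
  Kernel.deterministic (fun ω => ω ℓ) (measurable_pi_apply ℓ)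

/-- **The Dirac pair coupling** `(ω, ω') ↦ δ_{(ω_ℓ, ω'_ℓ)}` of the two identity kernels.
[cite: ConacheEtAl2015, §3.4 Lemma 3.8 (sites outside `D_{N−1}` are never reconstructed)] -/
def idPairKernel (ℓ : ι) : Kernel ((ι → S) × (ι → S)) (S × S) :=
  Kernel.deterministic (fun p => (p.1 ℓ, p.2 ℓ))
    (((measurable_pi_apply ℓ).comp measurable_fst).prodMk ((measurable_pi_apply ℓ).comp measurable_snd))

/-- Evaluation of the identity kernel. [cite: ConacheEtAl2015, §3.4 Lemma 3.8] -/
theorem idKernel_apply (ℓ : ι) (ω : ι → S) : idKernel ℓ ω = Measure.dirac (ω ℓ) := rfl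

/-- Evaluation of the Dirac pair coupling. [cite: ConacheEtAl2015, §3.4 Lemma 3.8] -/
theorem idPairKernel_apply (ℓ : ι) (p : (ι → S) × (ι → S)) :
    idPairKernel ℓ p = Measure.dirac (p.1 ℓ, p.2 ℓ) := rfl

/-- The identity kernel is Markov. [cite: ConacheEtAl2015, §3.4 Lemma 3.8] -/
instance isMarkovKernel_idKernel (ℓ : ι) : IsMarkovKernel (idKernel (S := S) ℓ) := by
  unfold idKernel; infer_instance

/-- The Dirac pair coupling is Markov. [cite: ConacheEtAl2015, §3.4 Lemma 3.8] -/
instance isMarkovKernel_idPairKernel (ℓ : ι) : IsMarkovKernel (idPairKernel (S := S) ℓ) := by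
  unfold idPairKernel; infer_instance

/-- **Every measure is invariant under identity resampling:**
`∫∫ f(ω[ℓ ↦ s]) δ_{ω_ℓ}(ds) μ(dω) = ∫ f dμ`. [cite: ConacheEtAl2015, §3.4 Lemma 3.8] -/
theorem lintegral_update_idKernel [DecidableEq ι] (μ : Measure (ι → S)) (ℓ : ι)
    {f : (ι → S) → ℝ≥0∞} (hf : Measurable f) :
    ∫⁻ ω, ∫⁻ s, f (update ω ℓ s) ∂(idKernel ℓ ω) ∂μ = ∫⁻ ω, f ω ∂μ := by
  refine lintegral_congr fun ω => ?_
  have hm : Measurable fun s => f (update ω ℓ s) := hf.comp (measurable_update ω)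
  rw [idKernel_apply, lintegral_dirac' _ hm]
  simp

/-- The first marginal of the Dirac pair is the identity kernel. [cite: ConacheEtAl2015, §3.4 Lemma 3.8] -/
theorem map_fst_idPairKernel (ℓ : ι) (p : (ι → S) × (ι → S)) :
    (idPairKernel ℓ p).map Prod.fst = idKernel ℓ p.1 := by
  rw [idPairKernel_apply, idKernel_apply, Measure.map_dirac' measurable_fst]

/-- The second marginal of the Dirac pair is the identity kernel. [cite: ConacheEtAl2015, §3.4 Lemma 3.8] -/
theorem map_snd_idPairKernel (ℓ : ι) (p : (ι → S) × (ι → S)) :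
    (idPairKernel ℓ p).map Prod.snd = idKernel ℓ p.2 := by
  rw [idPairKernel_apply, idKernel_apply, Measure.map_dirac' measurable_snd]

/-- No disagreement is created by the Dirac pair: `∫ d dδ_{(ω_ℓ, ω'_ℓ)} = d(ω_ℓ, ω'_ℓ)`.
[cite: ConacheEtAl2015, §3.4 Lemma 3.8] -/
theorem lintegral_idPairKernel (ℓ : ι) (p : (ι → S) × (ι → S)) {d : S × S → ℝ≥0∞}
    (hd : Measurable d) : ∫⁻ s, d s ∂(idPairKernel ℓ p) = d (p.1 ℓ, p.2 ℓ) := by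
  rw [idPairKernel_apply, lintegral_dirac' _ hd]

section glue

variable (Λ : Set ι) [DecidablePred (· ∈ Λ)]

/-- The one-site kernels `γ` on `Λ`, frozen (identity) off `Λ`. [cite: ConacheEtAl2015, §3.4 Lemma 3.8, §4.3] -/
def kernelOn (γ : ι → Kernel (ι → S) S) (ℓ : ι) : Kernel (ι → S) S :=
  if ℓ ∈ Λ then γ ℓ else idKernel ℓ

/-- The coupling kernels `q` on `Λ`, the Dirac pair off `Λ`. [cite: ConacheEtAl2015, §3.4 Lemma 3.8, §4.3] -/
def pairKernelOn (q : ι → Kernel ((ι → S) × (ι → S)) (S × S)) (ℓ : ι) :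
    Kernel ((ι → S) × (ι → S)) (S × S) :=
  if ℓ ∈ Λ then q ℓ else idPairKernel ℓ

variable {Λ}

/-- On `Λ` the glued kernel is `γ`. [cite: ConacheEtAl2015, §3.4 Lemma 3.8] -/
theorem kernelOn_of_mem (γ : ι → Kernel (ι → S) S) {ℓ : ι} (hℓ : ℓ ∈ Λ) :
    kernelOn Λ γ ℓ = γ ℓ := if_pos hℓ

/-- Off `Λ` the glued kernel is the identity kernel. [cite: ConacheEtAl2015, §3.4 Lemma 3.8] -/
theorem kernelOn_of_not_mem (γ : ι → Kernel (ι → S) S) {ℓ : ι} (hℓ : ℓ ∉ Λ) :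
    kernelOn Λ γ ℓ = idKernel ℓ := if_neg hℓ

/-- On `Λ` the glued coupling is `q`. [cite: ConacheEtAl2015, §3.4 Lemma 3.8] -/
theorem pairKernelOn_of_mem (q : ι → Kernel ((ι → S) × (ι → S)) (S × S)) {ℓ : ι} (hℓ : ℓ ∈ Λ) :
    pairKernelOn Λ q ℓ = q ℓ := if_pos hℓ

/-- Off `Λ` the glued coupling is the Dirac pair. [cite: ConacheEtAl2015, §3.4 Lemma 3.8] -/
theorem pairKernelOn_of_not_mem (q : ι → Kernel ((ι → S) × (ι → S)) (S × S)) {ℓ : ι}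
    (hℓ : ℓ ∉ Λ) : pairKernelOn Λ q ℓ = idPairKernel ℓ := if_neg hℓ

/-- The glued one-site kernels are Markov. [cite: ConacheEtAl2015, §3.4 Lemma 3.8] -/
instance isMarkovKernel_kernelOn (γ : ι → Kernel (ι → S) S) [∀ ℓ, IsMarkovKernel (γ ℓ)] (ℓ : ι) :
    IsMarkovKernel (kernelOn Λ γ ℓ) := by
  unfold kernelOn; split_ifs <;> infer_instance

/-- The glued coupling kernels are Markov. [cite: ConacheEtAl2015, §3.4 Lemma 3.8] -/
instance isMarkovKernel_pairKernelOn (q : ι → Kernel ((ι → S) × (ι → S)) (S × S))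
    [∀ ℓ, IsMarkovKernel (q ℓ)] (ℓ : ι) : IsMarkovKernel (pairKernelOn Λ q ℓ) := by
  unfold pairKernelOn; split_ifs <;> infer_instance

/-- **`OneSiteKernels` from hypotheses at the sites of `Λ` only.** If `μ` is invariant under
resampling every `ℓ ∈ Λ` from `γ_ℓ`, `μ'` under every `γ'_ℓ`, `ℓ ∈ Λ`, and `q_ℓ` couples `γ_ℓ(·|ω)` with
`γ'_ℓ(·|ω')` for `ℓ ∈ Λ`, then the glued families form Presutti's setup on the WHOLE index set (off
`Λ` nothing moves). This is how `μ^x = μ(·|ℱ_{D_{N−1}})(x)` and `μ` enter the coupling construction of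
Lemma 3.8. [cite: ConacheEtAl2015, §3.4 Lemma 3.8, §4.3] -/
theorem oneSiteKernels_on [DecidableEq ι] {μ μ' : Measure (ι → S)} {γ γ' : ι → Kernel (ι → S) S}
    {q : ι → Kernel ((ι → S) × (ι → S)) (S × S)}
    (hμ : ∀ ℓ ∈ Λ, ∀ f : (ι → S) → ℝ≥0∞, Measurable f →
      ∫⁻ ω, ∫⁻ s, f (update ω ℓ s) ∂(γ ℓ ω) ∂μ = ∫⁻ ω, f ω ∂μ)
    (hμ' : ∀ ℓ ∈ Λ, ∀ f : (ι → S) → ℝ≥0∞, Measurable f →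
      ∫⁻ ω', ∫⁻ s, f (update ω' ℓ s) ∂(γ' ℓ ω') ∂μ' = ∫⁻ ω', f ω' ∂μ')
    (hq : ∀ ℓ ∈ Λ, ∀ p, (q ℓ p).map Prod.fst = γ ℓ p.1)
    (hq' : ∀ ℓ ∈ Λ, ∀ p, (q ℓ p).map Prod.snd = γ' ℓ p.2) :
    OneSiteKernels μ μ' (kernelOn Λ γ) (kernelOn Λ γ') (pairKernelOn Λ q) := by
  refine ⟨fun ℓ f hf => ?_, fun ℓ f hf => ?_, fun ℓ p => ?_, fun ℓ p => ?_⟩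
  · by_cases hℓ : ℓ ∈ Λ
    · simpa [kernelOn_of_mem γ hℓ] using hμ ℓ hℓ f hf
    · simpa [kernelOn_of_not_mem γ hℓ] using lintegral_update_idKernel μ ℓ hf
  · by_cases hℓ : ℓ ∈ Λ
    · simpa [kernelOn_of_mem γ' hℓ] using hμ' ℓ hℓ f hf
    · simpa [kernelOn_of_not_mem γ' hℓ] using lintegral_update_idKernel μ' ℓ hf
  · by_cases hℓ : ℓ ∈ Λ
    · rw [pairKernelOn_of_mem q hℓ, kernelOn_of_mem γ hℓ]; exact hq ℓ hℓ p
    · rw [pairKernelOn_of_not_mem q hℓ, kernelOn_of_not_mem γ hℓ]; exact map_fst_idPairKernel ℓ p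
  · by_cases hℓ : ℓ ∈ Λ
    · rw [pairKernelOn_of_mem q hℓ, kernelOn_of_mem γ' hℓ]; exact hq' ℓ hℓ p
    · rw [pairKernelOn_of_not_mem q hℓ, kernelOn_of_not_mem γ' hℓ]; exact map_snd_idPairKernel ℓ p

end glue

end ResampleOffRegion

end Literature.Probability.TransportMaps
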